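import Literature.AlgebraicGeometry.HodgeTheory.ArapuraSurfaceFibredFourfoldsSplitRelativeDivisors
import Literature.AlgebraicGeometry.HodgeTheory.PgZeroSurfaceFamilyFiniteMonodromy
import Literature.AlgebraicGeometry.HodgeTheory.DivisorClassesFiniteEtaleBaseChange
import Literature.AlgebraicGeometry.HodgeTheory.SpreadSupportsOfSmoothFamily
import Literature.AlgebraicGeometry.Motives.SmoothSpread
import HarnessLib

/-!
# Arapura (2022), Cor. 1.5 on the smooth part, modulo Riemann existence and the global invariant cycle theorem

Topic `Literature/AlgebraicGeometry/HodgeTheory`, fifth proof file of the named fact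
`Arapura2022_thm_1_2_smoothPart_pgZeroSurfaceFibration` (`ArapuraSurfaceFibredFourfoldsSplit.lean`;
D. Arapura, *Hodge cycles and the Leray filtration*, Pacific J. Math. **319** (2022), Cor. 1.5 with
Thm. 1.2 and Cor. 1.4). `ArapuraSurfaceFibredFourfoldsSplitRelativeDivisors.lean` reduced the fact
to the hypothesis `hF` of
`Arapura2022_thm_1_2_smoothPart_pgZeroSurfaceFibration_of_affineFiniteEtaleBaseChange` — the
printed sentence "after a finite base change, `[𝒵_1], …, [𝒵_N]` gives a basis of `R²f_*ℚ`" (p. 5):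
an affine open `U₀ ⊆ Y ∖ T` over which `f` is smooth, a finite étale cover `U' → U₀` and divisor
classes on `X_{U₀} ×_{U₀} U'` spanning `H²` of one fibre. The paper obtains them from relative
Hilbert schemes (absent from the tree); this file obtains them from the MONODROMY ARGUMENT, i.e.
proves the fact GRANTED the two named facts of the tree on which that argument rests:

* `FundamentalGroup.riemannExistence_finiteCovering` — Riemann's existence theorem over `ℂ`,
  covering form [SGA1, Exp. XII Thm. 5.1];
* `deligne_globalInvariantCycles` — Deligne's théorème de la partie fixe [Hodge II, Thm. 4.1.1].

Steps (all PROVED here or in the tree): generic smoothness in characteristic `0` — an affine open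
neighbourhood `U₀` of the generic point of `Y`, missing `T` and the (closed) image of the
non-smooth locus of `f` (`mem_smoothLocus_of_apply_eq_genericPoint_of_smooth`, Hartshorne III
Cor. 10.7), so that `X_{U₀} → U₀` is a smooth projective family of surfaces with `p_g = 0`
(`isSmoothProjectiveFamily_familyPullback_snd_of_smooth`); finite monodromy on `H²` of a fibre
(`finite_setOf_isContinuationAlong_of_pg_zero`, file `PgZeroSurfaceFamilyFiniteMonodromy`: the
lattice argument with the signed Hodge index theorem); the finite étale base change with divisor
classes spanning `H²` of a fibre (`exists_finiteEtale_algebraicClasses_span_of_finite_monodromy`,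
file `DivisorClassesFiniteEtaleBaseChange`: Riemann existence, invariant sections, Hironaka
compactification, global invariant cycles + Hodge lift, Lefschetz `(1,1)`); and the assembled
reduction of the previous files (transfer along the finite étale cover, hard Lefschetz on the fibres,
the coniveau criterion with `h3`, `hD`, `hV` all theorems of the tree).

Main result: `Arapura2022_thm_1_2_smoothPart_pgZeroSurfaceFibration_holds_of_riemannExistence_of_globalInvariantCycles
(hRE) (hGIC) : Arapura2022_thm_1_2_smoothPart_pgZeroSurfaceFibration`.

## References

* D. Arapura, *Hodge cycles and the Leray filtration*, Pacific J. Math. 319 (2022) 233–258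
  (arXiv:2103.05038), Thm. 1.2, Cor. 1.4, Cor. 1.5 and its proof (p. 5). [Arapura2022]
* C. Voisin, *Hodge loci and absolute Hodge classes*, Compositio Math. 143 (2007), §3, proof of
  Prop. 0.7 (the monodromy argument). [Voisin2007HodgeLoci]
* A. Grothendieck, M. Raynaud, *SGA 1*, Exp. XII Thm. 5.1. [SGA1]
* P. Deligne, *Théorie de Hodge II*, Publ. Math. IHÉS 40 (1971), Thm. 4.1.1, 4.2. [DeligneHodgeII1971]
* R. Hartshorne, *Algebraic Geometry*, GTM 52 (1977), III Cor. 10.7 (generic smoothness). [Hartshorne1977]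
-/

noncomputable section

open Set Function CategoryTheory CategoryTheory.Limits AlgebraicGeometry Topology
open Literature.AlgebraicTopology.SingularHomology

namespace Literature.AlgebraicGeometry.HodgeTheory

section HodgeTheory

universe u

/-! ### Generic smoothness: an affine open of the base over which `f` is smooth -/

/-- Over a locally Noetherian base, locally of finite type implies locally of finite presentation
(private copy of `locallyOfFinitePresentation_of_isLocallyNoetherian` of `AlgebraicityLocusCurves`,
to keep the imports of this file light). [folklore] -/
private theorem locallyOfFinitePresentation_of_isLocallyNoetherian'' {X Y : Scheme.{u}} (g : X ⟶ Y)
    [IsLocallyNoetherian Y] [LocallyOfFiniteType g] : LocallyOfFinitePresentation g := by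
  rw [HasRingHomProperty.iff_appLE (P := @LocallyOfFinitePresentation)]
  intro U V e
  haveI := IsLocallyNoetherian.component_noetherian (X := Y) U
  exact RingHom.FinitePresentation.of_finiteType.mp
    (HasRingHomProperty.appLE @LocallyOfFiniteType g inferInstance U V e)

/-- **Generic smoothness over an affine open of the base** ("choose a nonempty Zariski open subset
`U ⊂ Y` such that `f` is smooth over `U`", Arapura p. 3; Hartshorne III Cor. 10.7). Let
`f : X ⟶ Y` be a morphism of `ℂ`-schemes with `X → Spec ℂ` smooth of some relative dimension, `X`
proper over `ℂ`, `Y` integral, separated and locally of finite type over `ℂ`, and `T ⊊ Y` a proper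
closed subset. Then there is an AFFINE open `U₀ ⊆ Y` containing the generic point, disjoint from
`T`, over which `f` is smooth (`X ×_Y U₀ → U₀` smooth): the points of `X` over the generic point
lie in the open smooth locus of `f` (`mem_smoothLocus_of_apply_eq_genericPoint_of_smooth`,
characteristic `0`), the image of its closed complement is closed (`f` is proper) and misses the
generic point, and affine opens form a basis. [cite: Hartshorne1977, III Cor. 10.7]
[cite: Arapura2022, §1 p. 3] -/
theorem exists_affineOpen_smooth_pullback_snd {X Y : Motives.SchemeOver ℂ} (f : X ⟶ Y) (N : ℕ)
    [SmoothOfRelativeDimension N X.hom] [IsProper X.hom] [IsIntegral Y.left] [IsSeparated Y.hom]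
    [LocallyOfFiniteType Y.hom] {T : Set Y.left} (hTc : IsClosed T) (hTne : T ≠ Set.univ) :
    ∃ U₀ : Y.left.Opens, IsAffineOpen U₀ ∧ genericPoint Y.left ∈ U₀ ∧ Disjoint (U₀ : Set Y.left) T ∧
      Smooth (pullback.snd f.left U₀.ι) := by
  haveI : IsProper f.left := by
    have h : IsProper (f.left ≫ Y.hom) := by rw [Over.w f]; infer_instance
    exact IsProper.of_comp f.left Y.hom
  haveI : LocallyOfFiniteType f.left := by
    have h : LocallyOfFiniteType (f.left ≫ Y.hom) := by rw [Over.w f]; infer_instance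
    exact locallyOfFiniteType_of_comp f.left Y.hom
  haveI : IsLocallyNoetherian Y.left := LocallyOfFiniteType.isLocallyNoetherian Y.hom
  haveI : LocallyOfFinitePresentation f.left := locallyOfFinitePresentation_of_isLocallyNoetherian'' f.left
  set η : Y.left := genericPoint Y.left with hη
  -- the generic point misses `T` and the image `C` of the non-smooth locus
  have hηT : η ∉ T := fun h ↦ hTne (Set.eq_univ_of_univ_subset (by
    have h1 : closure ({η} : Set Y.left) ⊆ T := closure_minimal (Set.singleton_subset_iff.2 h) hTc
    rwa [hη, genericPoint_closure] at h1))
  set C : Set Y.left := f.left.base '' ((f.left.smoothLocus : Set X.left)ᶜ) with hC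
  have hCc : IsClosed C := f.left.isClosedMap _ f.left.smoothLocus.isOpen.isClosed_compl
  have hηC : η ∉ C := by
    rintro ⟨x, hx, hxη⟩
    exact hx (mem_smoothLocus_of_apply_eq_genericPoint_of_smooth f N hxη)
  -- an affine open neighbourhood `U₀` of `η` inside `(C ∪ T)ᶜ`
  obtain ⟨_, ⟨(U₀ : Y.left.Opens), hU₀, rfl⟩, hηU₀, hU₀sub⟩ :=
    Y.left.isBasis_affineOpens.exists_subset_of_mem_open
      (show η ∈ (C ∪ T)ᶜ from fun h ↦ h.elim hηC hηT) (hCc.union hTc).isOpen_compl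
  refine ⟨U₀, hU₀, hηU₀, Set.disjoint_left.2 fun y hy hyT ↦ hU₀sub hy (Or.inr hyT), ?_⟩
  -- smoothness over `U₀`: the open subscheme `X ×_Y U₀ ⊆ X` lies in the smooth locus of `f`
  have h1 : Smooth (pullback.fst f.left U₀.ι ≫ f.left) := by
    rw [← Scheme.Hom.smoothLocus_eq_top_iff, ← Scheme.Hom.preimage_smoothLocus_eq, eq_top_iff]
    rintro x -
    show (pullback.fst f.left U₀.ι).base x ∈ f.left.smoothLocus
    by_contra hx
    have hmem : f.left.base ((pullback.fst f.left U₀.ι).base x) ∈ (U₀ : Set Y.left) := by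
      have h : (pullback.fst f.left U₀.ι ≫ f.left).base x = (pullback.snd f.left U₀.ι ≫ U₀.ι).base x := by
        rw [pullback.condition]
      rw [Scheme.Hom.comp_apply, Scheme.Hom.comp_apply] at h
      rw [h]
      exact ((pullback.snd f.left U₀.ι).base x).2
    exact hU₀sub hmem (Or.inl ⟨_, hx, rfl⟩)
  rw [pullback.condition] at h1
  exact MorphismProperty.of_postcomp (W := @Smooth) (W' := @IsOpenImmersion)
    (pullback.snd f.left U₀.ι) U₀.ι inferInstance h1

/-! ### The smooth projective family over the affine open -/

/-- **`X_{U₀} ⟶ U₀` is a smooth projective family of surfaces** for `f : X ⟶ Y` as in Cor. 1.5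
(`X` a smooth projective fourfold over the surface `Y`, fibres off `T` smooth projective surfaces)
and an affine open `j₀ : U₀ ↪ Y` missing `T` over which `f` is smooth: the base change is proper,
its rational fibres are the fibres of `f` off `T` (`Motives.fiberOverFamilyPullbackIso`), and its
relative dimension is that of a fibre (`Motives.exists_smoothOfRelativeDimension_of_smooth` on the
integral `X_{U₀}`, `SmoothSpread.eq_of_smoothOfRelativeDimension` on a complex fibre).
[cite: Arapura2022, proof of Cor. 1.5 (p. 5)] [cite: Hartshorne1977, III Prop. 10.1] -/
theorem isSmoothProjectiveFamily_familyPullback_snd_of_smooth {X Y U : Motives.SchemeOver ℂ} (f : X ⟶ Y)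
    (hX : Motives.IsSmoothProjective 4 X) (hY : Motives.IsSmoothProjective 2 Y)
    (hf : Function.Surjective f.left.base) (j₀ : U ⟶ Y) [IsOpenImmersion j₀.left]
    [Nonempty U.left] {T : Set Y.left} (hj₀T : ∀ u : U.left, j₀.left.base u ∉ T)
    (hfibT : ∀ s : Motives.AlgPoints Y ℂ, s.pt ∉ T → Motives.IsSmoothProjective 2 (Motives.fiberOver f s))
    (hsm : Smooth (Motives.familyPullback.snd f j₀).left) :
    Motives.IsSmoothProjectiveFamily (Motives.familyPullback.snd f j₀) 2 := by
  haveI : IsIntegral X.left := Motives.IsSmoothProjective.isIntegral_holds hX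
  haveI : IsIntegral Y.left := Motives.IsSmoothProjective.isIntegral_holds hY
  haveI : IsProper X.hom := hX.isProjectiveOver.isProper
  haveI : IsProper Y.hom := hY.isProjectiveOver.isProper
  haveI : IsProper f.left := by
    have h : IsProper (f.left ≫ Y.hom) := by rw [Over.w f]; infer_instance
    exact IsProper.of_comp f.left Y.hom
  haveI := hsm
  -- the rational fibres of the base change are fibres of `f` off `T`
  have hfib : ∀ s : Motives.ComplexPoints U,
      Motives.IsSmoothProjective 2 (Motives.fiberOver (Motives.familyPullback.snd f j₀) s) := fun s ↦
    (hfibT _ (by rw [Motives.AlgPoints.pt_map]; exact hj₀T _)).of_iso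
      (Motives.fiberOverFamilyPullbackIso f j₀ s).symm
  -- `X_{U₀}` is integral (an open subscheme of `X`, non-empty since `f` is onto)
  haveI : IsOpenImmersion (Motives.familyPullback.fst f j₀).left := by
    change IsOpenImmersion (pullback.fst f.left j₀.left); infer_instance
  haveI : Nonempty (Motives.familyPullback f j₀).left := by
    obtain ⟨u⟩ := ‹Nonempty U.left›
    obtain ⟨x, hx⟩ := hf (j₀.left.base u)
    obtain ⟨z, -, -⟩ := Scheme.Pullback.exists_preimage_pullback (f := f.left) (g := j₀.left) x u hx
    exact ⟨z⟩
  haveI : IsIntegral (Motives.familyPullback f j₀).left :=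
    isIntegral_of_isOpenImmersion (Motives.familyPullback.fst f j₀).left
  -- the relative dimension is `2`, read off on a complex fibre
  obtain ⟨m, hm⟩ := Motives.exists_smoothOfRelativeDimension_of_smooth (Motives.familyPullback.snd f j₀).left
  haveI := hm
  haveI : LocallyOfFiniteType U.hom := by
    have h : LocallyOfFiniteType (j₀.left ≫ Y.hom) := inferInstance
    rwa [Over.w j₀] at h
  obtain ⟨s₀, -⟩ := exists_complexPoint_pt_not_mem (Y := U) isClosed_empty (Set.empty_ne_univ)
  have h2 : m = 2 := by
    have hXs := hfib s₀
    haveI : IsIntegral (Motives.fiberOver (Motives.familyPullback.snd f j₀) s₀).left :=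
      Motives.IsSmoothProjective.isIntegral_holds hXs
    haveI h2' := hXs.smoothOfRelativeDimension
    -- the fibre is smooth of relative dimension `m` over `ℂ` by base change
    haveI := smoothOfRelativeDimension_isStableUnderBaseChange (n := m)
    have hm' : SmoothOfRelativeDimension m
        (pullback.snd (Motives.familyPullback.snd f j₀).left s₀.left) :=
      MorphismProperty.pullback_snd (P := @SmoothOfRelativeDimension m) _ _ hm
    haveI : IsIso (Motives.specOver ℂ ℂ).hom := by
      change IsIso (Spec.map (CommRingCat.ofHom (algebraMap ℂ ℂ)))
      rw [Algebra.algebraMap_self, CommRingCat.ofHom_id, Spec.map_id]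
      infer_instance
    have hm'' : SmoothOfRelativeDimension m (Motives.fiberOver (Motives.familyPullback.snd f j₀) s₀).hom := by
      rw [Motives.fiberOver_hom]
      exact (MorphismProperty.cancel_right_of_respectsIso (@SmoothOfRelativeDimension m) _ _).2 hm'
    obtain ⟨x⟩ := (inferInstance : Nonempty (Motives.fiberOver (Motives.familyPullback.snd f j₀) s₀).left)
    exact Motives.SmoothSpread.eq_of_smoothOfRelativeDimension _ (hd := hm'') (hn := h2') x
  subst h2
  refine ⟨hm, ?_, hfib⟩
  change IsProper (pullback.snd f.left j₀.left)
  infer_instance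

/-! ### The named fact, granted Riemann existence and the global invariant cycle theorem -/

/-- **Arapura (2022), Cor. 1.5 on the smooth part** (`Arapura2022_thm_1_2_smoothPart_pgZeroSurfaceFibration`:
for `f : X → Y` from a smooth projective fourfold onto a smooth projective surface with connected
fibres, generically smooth projective surfaces with `p_g = 0`, every rational `(2,2)`-class of `X`
is algebraic up to a class dying off `f⁻¹T` for a proper closed `T ⊊ Y`), PROVED GRANTED the two
named facts `FundamentalGroup.riemannExistence_finiteCovering` (SGA1 XII Thm. 5.1) and
`deligne_globalInvariantCycles` (Hodge II Thm. 4.1.1). The printed proof's "after a finite base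
change, `[𝒵_1], …, [𝒵_N]` gives a basis of `R²f_*ℚ`" (p. 5, via relative Hilbert schemes) is
supplied by the monodromy argument instead: over an affine open `U₀ ∋ η` missing `T` and the
non-smooth locus (`exists_affineOpen_smooth_pullback_snd`), `X_{U₀} → U₀` is a smooth projective
family of `p_g = 0` surfaces (`isSmoothProjectiveFamily_familyPullback_snd_of_smooth`); a rational
basis of `H²` of one fibre (`span_isRationalClass_eq_top_of_isSmoothProjective_holds`) consists of
`(1,1)`-classes (`isOfHodgeType_one_one_of_pg_zero`) with FINITE monodromy orbits
(`finite_setOf_isContinuationAlong_of_pg_zero`), hence extends to divisor classes on a finite étale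
base change (`exists_finiteEtale_algebraicClasses_span_of_finite_monodromy`, where the two facts
enter), which is the hypothesis of
`Arapura2022_thm_1_2_smoothPart_pgZeroSurfaceFibration_of_affineFiniteEtaleBaseChange`.
[cite: Arapura2022, Thm. 1.2, Cor. 1.4, Cor. 1.5 and proof of Cor. 1.5 (p. 5)]
[cite: Voisin2007HodgeLoci, §3, proof of Prop. 0.7] [cite: SGA1, Exp. XII Thm. 5.1]
[cite: DeligneHodgeII1971, Théorème 4.1.1 and 4.2] -/
theorem Arapura2022_thm_1_2_smoothPart_pgZeroSurfaceFibration_holds_of_riemannExistence_of_globalInvariantCycles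
    (hRE : FundamentalGroup.riemannExistence_finiteCovering) (hGIC : deligne_globalInvariantCycles) :
    Arapura2022_thm_1_2_smoothPart_pgZeroSurfaceFibration := by
  refine Arapura2022_thm_1_2_smoothPart_pgZeroSurfaceFibration_of_affineFiniteEtaleBaseChange ?_
  intro X Y f hX hY hf hconn T hTc hTne hfibT
  haveI := hX.smoothOfRelativeDimension
  haveI := hY.smoothOfRelativeDimension
  haveI : IsIntegral Y.left := Motives.IsSmoothProjective.isIntegral_holds hY
  haveI : IsIntegral X.left := Motives.IsSmoothProjective.isIntegral_holds hX
  haveI : IsProper X.hom := hX.isProjectiveOver.isProper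
  haveI : IsProper Y.hom := hY.isProjectiveOver.isProper
  haveI : IsSeparated Y.hom := inferInstance
  -- Step 1 (generic smoothness): the affine open `U₀ ∋ η` missing `T`, `f` smooth over it
  obtain ⟨U₀, hU₀aff, hηU₀, hU₀T, hsm⟩ := exists_affineOpen_smooth_pullback_snd f 4 hTc hTne
  let U : Motives.SchemeOver ℂ := Over.mk (U₀.ι ≫ Y.hom)
  let j₀ : U ⟶ Y := Over.homMk U₀.ι rfl
  have hj₀l : j₀.left = U₀.ι := rfl
  haveI hj₀ : IsOpenImmersion j₀.left := by change IsOpenImmersion U₀.ι; infer_instance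
  haveI hUaff : IsAffine U.left := hU₀aff
  haveI : Nonempty U.left := ⟨(⟨genericPoint Y.left, hηU₀⟩ : U₀)⟩
  have hj₀T : ∀ u : U.left, j₀.left.base u ∉ T := fun u ↦
    Set.disjoint_left.1 hU₀T (show U₀.ι.base u ∈ (U₀ : Set Y.left) from (u : U₀).2)
  have hsm' : Smooth (Motives.familyPullback.snd f j₀).left := hsm
  -- Step 2: the smooth projective family `π : X_{U₀} ⟶ U₀` of `p_g = 0` surfaces
  set π := Motives.familyPullback.snd f j₀ with hπ
  have hπ : Motives.IsSmoothProjectiveFamily π 2 :=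
    isSmoothProjectiveFamily_familyPullback_snd_of_smooth f hX hY hf j₀ hj₀T (fun s hs ↦ (hfibT s hs).1) hsm'
  have hUqp : IsQuasiProjectiveOver U := ⟨Y, j₀, hY.isProjectiveOver, hj₀⟩
  haveI : IsOpenImmersion (Motives.familyPullback.fst f j₀).left := by
    change IsOpenImmersion (pullback.fst f.left j₀.left); infer_instance
  have h𝒳qp : IsQuasiProjectiveOver (Motives.familyPullback f j₀) :=
    ⟨X, Motives.familyPullback.fst f j₀, hX.isProjectiveOver, inferInstance⟩
  haveI : SmoothOfRelativeDimension 2 U.hom := by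
    have h : SmoothOfRelativeDimension (0 + 2) (j₀.left ≫ Y.hom) := inferInstance
    rw [Over.w j₀] at h
    simpa using h
  haveI : Smooth U.hom := SmoothOfRelativeDimension.smooth 2 _
  haveI : IrreducibleSpace U.left := by
    haveI : IsIntegral U.left := isIntegral_of_isOpenImmersion j₀.left
    infer_instance
  haveI : LocallyOfFiniteType U.hom := hUqp.locallyOfFiniteType
  -- Step 3: a fibre `X_{s₀}`, `s₀ ∈ U₀(ℂ)`; a rational basis of its `H²`, of type `(1,1)`
  obtain ⟨s₀, -⟩ := exists_complexPoint_pt_not_mem (Y := U) isClosed_empty (Set.empty_ne_univ)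
  have hXs : Motives.IsSmoothProjective 2 (Motives.fiberOver π s₀) := hπ.isSmoothProjective s₀
  -- `p_g = 0` for this fibre: transport a Hodge model of the isomorphic fibre of `f`
  obtain ⟨A₀, hA₀⟩ := (hfibT _ (show (Motives.AlgPoints.map j₀ s₀).pt ∉ T by
    rw [Motives.AlgPoints.pt_map]; exact hj₀T _)).2
  let A : HodgeModel 2 (Motives.fiberOver π s₀) :=
    { A₀ with
      toComplexPoints := Motives.AlgPoints.map (Motives.fiberOverFamilyPullbackIso f j₀ s₀).symm.hom ∘
        A₀.toComplexPoints
      isAnalytification :=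
        A₀.isAnalytification.transport_iso (Motives.fiberOverFamilyPullbackIso f j₀ s₀).symm }
  have hA : Module.finrank ℂ ↥(A.hodgePQ 2 2 0) = 0 := hA₀
  haveI := finite_complexBetti hXs (2 * 1)
  obtain ⟨α, hαr, hαspan, -⟩ := Submodule.exists_fun_fin_finrank_span_eq ℂ
    {c : complexBetti (Motives.fiberOver π s₀) (2 * 1) | IsRationalClass c}
  replace hαspan : Submodule.span ℂ (Set.range α) = ⊤ :=
    hαspan.trans (span_isRationalClass_eq_top_of_isSmoothProjective_holds 2 _ hXs (2 * 1))
  have hαh : ∀ i, IsOfHodgeType 2 (Motives.fiberOver π s₀) (2 * 1) 1 1 (α i) := fun i ↦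
    isOfHodgeType_one_one_of_pg_zero hXs A hA (α i)
  -- Step 4 (finite monodromy): the fibre embeds in `ℙᴹ` through `X_{U₀} ⊆ X ⊆ ℙᴹ`
  obtain ⟨M, ιX, hιX⟩ := hX.isProjectiveOver
  haveI := hιX
  haveI : IsClosedImmersion (Motives.fiberι π s₀ ≫ Motives.familyPullback.fst f j₀ ≫ ιX).left := by
    have h1 := Motives.fiberOverFamilyPullbackIso_hom_fiberι f j₀ s₀
    haveI : IsClosedImmersion (Motives.fiberι f (Motives.AlgPoints.map j₀ s₀)).left := by
      haveI : IsClosedImmersion (Motives.AlgPoints.map j₀ s₀).left :=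
        Motives.CurveNet.isClosedImmersion_left_of_isSeparated _
      rw [Motives.fiberι_left]
      exact MorphismProperty.pullback_fst (P := @IsClosedImmersion) _ _ inferInstance
    have hcomp : Motives.fiberι π s₀ ≫ Motives.familyPullback.fst f j₀ ≫ ιX =
        (Motives.fiberOverFamilyPullbackIso f j₀ s₀).hom ≫
          Motives.fiberι f (Motives.AlgPoints.map j₀ s₀) ≫ ιX := by
      rw [← Category.assoc, ← h1, Category.assoc]
    rw [hcomp, Over.comp_left, Over.comp_left]
    infer_instance
  have hfin : ∀ i, {β : complexBetti (Motives.fiberOver π s₀) (2 * 1) |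
      ∃ γ : Path s₀ s₀, IsContinuationAlong γ (α i) β}.Finite := fun i ↦
    finite_setOf_isContinuationAlong_of_pg_zero π 2 hπ hUqp s₀ ⟨A, hA⟩
      (Motives.familyPullback.fst f j₀ ≫ ιX) (α i) (hαr i)
  -- Step 5 (Riemann existence + global invariant cycles): divisor classes after a finite étale
  -- base change, spanning `H²` of a fibre
  obtain ⟨U', e, he₁, he₂, he₃, hirr, s', ζ, hζ, hspan⟩ :=
    exists_finiteEtale_algebraicClasses_span_of_finite_monodromy hRE hGIC π hπ h𝒳qp hUqp s₀ α hαr hαh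
      hfin hαspan
  exact ⟨U, j₀, hj₀, hUaff, hj₀T, hsm', U', e, he₁, he₂, he₃, hirr, _, ζ, hζ, s', hspan⟩

end HodgeTheory

end Literature.AlgebraicGeometry.HodgeTheory

end
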